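import Mathlib
import Summits.Ventures.PercRepro2.Defs
import Summits.Ventures.PercRepro2.Graph
import Summits.Ventures.PercRepro2.OneColourSwitch
import Summits.Ventures.PercRepro2.M9PendantMirror
import Summits.Ventures.PercRepro2.M9LoopTransfer
import Summits.Ventures.PercRepro2.M9PendantSeries
import Summits.Ventures.PercRepro2.M9ReducibleClass
import Summits.Ventures.PercRepro2.M9ParallelContract
import Summits.Ventures.PercRepro2.M9ReducibleSP
import Summits.Ventures.PercRepro2.M9NoPocketDefs
import Summits.Ventures.PercRepro2.M9NoPocketM9

/-!
# The series–parallel reducible class with the no-pocket single-`d` base (blind cell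
PercRepro2, p3 g20, 2026-08-27; `proofs/P3-CPNC.md` §17c, §17g)

`ReducibleNP p q r s ends` is `ReducibleSP` (`M9ReducibleSP`: the `DZero` and cut-vertex bases,
the pair swap, the pendant, series and parallel reductions) with ONE MORE BASE: the no-pocket
single-`d` class of `M9NoPocketM9` — a non-mark `d` such that every other non-mark is adjacent to
`p` or `q` and every neighbour of `d` other than `r, s` is adjacent to `r` or `s`.
`m9SignSum_nonpos_of_reducibleNP` proves `Σ_{Sep} σ_pq · σ_rs ≤ 0` on the whole class.
Own work, one seat.
-/

namespace Summit.Ventures.PercRepro2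

namespace M9Reduce

open OneColourSwitch Classical Finset SideSwitch

variable {V : Type*} {E : Type*}

section ReducibleNP

variable [Fintype V] [DecidableEq V] [Fintype E] [DecidableEq E]

/-- The series–parallel reducible class with the no-pocket single-`d` base. -/
inductive ReducibleNP : V → V → V → V → (E → Sym2 V) → Prop
  /-- every `ReducibleSP` graph -/
  | ofReducibleSP {p q r s : V} {ends : E → Sym2 V} (h : ReducibleSP p q r s ends) :
      ReducibleNP p q r s ends
  /-- the no-pocket single-`d` class: every non-mark other than `d` adjacent to `p` or `q`,
  every neighbour of `d` other than `r, s` adjacent to `r` or `s` -/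
  | noPocket {p q r s d : V} {ends : E → Sym2 V} (hnp : NoPocket.NoPocketAt ends d r s)
      (hadj : ∀ x, Nonmark p q r s x → x ≠ d → ∃ e, ends e = s(x, p) ∨ ends e = s(x, q))
      (hpd : p ≠ d) (hqd : q ≠ d) (hr : d ≠ r) (hs : d ≠ s) : ReducibleNP p q r s ends
  /-- the pair swap -/
  | swap {p q r s : V} {ends : E → Sym2 V} (h : ReducibleNP r s p q ends) :
      ReducibleNP p q r s ends
  /-- the pendant reduction -/
  | pendant {p q r s : V} {ends : E → Sym2 V} {e₀ : E} {d v : V}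
      (hd : ∀ e, d ∈ ends e → ¬ (ends e).IsDiag → e = e₀) (he₀ : ends e₀ = s(d, v))
      (hp : p ≠ d) (hq : q ≠ d) (hr : r ≠ d) (hs : s ≠ d)
      (h : ReducibleNP p q r s (Function.update ends e₀ s(d, d))) : ReducibleNP p q r s ends
  /-- the series reduction -/
  | series {p q r s : V} {ends : E → Sym2 V} {e₁ e₂ : E} {d x y : V} (hne : e₁ ≠ e₂)
      (hd : ∀ e, d ∈ ends e → ¬ (ends e).IsDiag → e = e₁ ∨ e = e₂)
      (h₁ : ends e₁ = s(d, x)) (h₂ : ends e₂ = s(d, y)) (hx : x ≠ d) (hy : y ≠ d)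
      (hp : p ≠ d) (hq : q ≠ d) (hr : r ≠ d) (hs : s ≠ d)
      (hG₁ : ReducibleNP p q r s (Function.update (Function.update ends e₁ s(x, y)) e₂ s(d, d)))
      (hG₀ : ReducibleNP p q r s (Function.update (Function.update ends e₁ s(d, d)) e₂ s(d, d))) :
      ReducibleNP p q r s ends
  /-- the parallel reduction -/
  | parallel {p q r s : V} {ends : E → Sym2 V} {e₁ e₂ : E} {x y : V} (hne : e₁ ≠ e₂)
      (h₁ : ends e₁ = s(x, y)) (h₂ : ends e₂ = s(x, y))
      (hp : p ≠ y) (hq : q ≠ y) (hr : r ≠ y) (hs : s ≠ y)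
      (hG₁ : ReducibleNP p q r s (Function.update ends e₂ s(x, x)))
      (hGc : ReducibleNP p q r s (contract ends x y)) : ReducibleNP p q r s ends

/-- **`m9` in sign form on the reducible class with the no-pocket base**:
`Σ_{Sep} σ_pq · σ_rs ≤ 0` on every marked multigraph that series–parallel-reduces at non-marks
to a `DZero` graph, a cut-vertex graph or a no-pocket single-`d` graph. -/
theorem m9SignSum_nonpos_of_reducibleNP {p q r s : V} {ends : E → Sym2 V}
    (h : ReducibleNP p q r s ends) : m9SignSum ends p q r s ≤ 0 := by
  induction h with
  | ofReducibleSP h => exact m9SignSum_nonpos_of_reducibleSP h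
  | noPocket hnp hadj hpd hqd hr hs =>
    exact NoPocket.m9SignSum_nonpos_of_singleD_noPocket hnp hadj hpd hqd hr hs
  | swap _ ih => rw [m9SignSum_comm]; exact ih
  | pendant hd he₀ hp hq hr hs _ ih => rw [m9SignSum_pendant hd he₀ hp hq hr hs]; exact ih
  | series hne hd h₁ h₂ hx hy hp hq hr hs _ _ ih₁ ih₀ =>
    have hid := m9SignSum_series hne hd h₁ h₂ hx hy hp hq hr hs
    linarith
  | parallel hne h₁ h₂ hp hq hr hs _ _ ih₁ ihc =>
    exact m9SignSum_nonpos_of_parallel hne h₁ h₂ hp hq hr hs ih₁ ihc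

end ReducibleNP

end M9Reduce

end Summit.Ventures.PercRepro2
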